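import Mathlib
import Summits.Ventures.PercRepro2.MixChordOTwoRootStar

/-!
# Connectivity with ONE EXTRA EDGE on a cut-vertex graph (blind cell PercRepro2, night-1 g23;
proofs/NIGHT1-G23.md §6 — the combinatorial half of the pendant-block class)

The graph without the edge `e = {a₃, a₁}` has a cut vertex `v` with `a₃` on the left side `L`; `e` joins
`a₃` to the right vertex `a₁`.

* **`conn_iff_of_open_edge`** (one extra edge, any graph): with `e` open, a connection either avoids `e` or
  passes through it — `x ↔ y` iff `x ↔₀ y`, or `x ↔₀ a₃ ∧ a₁ ↔₀ y`, or `x ↔₀ a₁ ∧ a₃ ↔₀ y` (`↔₀` = with `e`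
  closed); a walk induction.
* `res S` (the restriction of a configuration to the edges of `S`, inverse to `Support.ext`), and the
  reading of connections on the graph without `e`: with `e` closed they are those of the restricted graph
  (`conn_iff_closed`); with `e` open, on the cut-vertex graph with `a₃ ↮ v`, every connection among right
  vertices is a connection of the restricted graph (**`conn_right_iff_open`**), and `Q = {a₁ ↮ v}` reads as
  `{a₁ ↮ v} ∩ {a₃ ↮ v}` (**`Q_iff_open`**).

The probabilistic half (the scaling identity and the chord) is MixChordOPendantBlock.lean.  Own code;
standard axioms.
-/

namespace Summit.Ventures.PercRepro2

open UnionCluster CovForm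

namespace Mix

namespace Block

open Support Star CutVertexM9

section OneEdge

variable {V : Type*} {E : Type*} [DecidableEq E] {ends : E → Sym2 V} {e : E} {a₁ a₃ : V}

/-- **One extra edge**: with `e = {a₃, a₁}` open in `ω`, a connection either avoids `e` or uses it. -/
theorem conn_iff_of_open_edge (he : ends e = s(a₃, a₁)) {ω : Config E} (hω : ω e = true) (x y : V) :
    Conn ends ω x y ↔ Conn ends (Function.update ω e false) x y ∨
      (Conn ends (Function.update ω e false) x a₃ ∧ Conn ends (Function.update ω e false) a₁ y) ∨
      (Conn ends (Function.update ω e false) x a₁ ∧ Conn ends (Function.update ω e false) a₃ y) := by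
  have hle : Function.update ω e false ≤ ω := by
    intro e'
    by_cases h : e' = e
    · subst h; simp
    · simp [Function.update_of_ne h]
  have hea : Conn ends ω a₃ a₁ := conn_of_openAdj ⟨e, hω, he⟩
  constructor
  · intro h
    obtain ⟨w⟩ := h
    induction w with
    | nil => exact Or.inl (conn_refl _ _ _)
    | @cons x z y hadj w ih =>
      rw [openGraph_adj] at hadj
      obtain ⟨-, e', he', hends'⟩ := hadj
      by_cases hee : e' = e
      · subst hee
        rw [he] at hends'
        rcases Sym2.eq_iff.1 hends' with ⟨rfl, rfl⟩ | ⟨rfl, rfl⟩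
        · rcases ih with h1 | ⟨h2, h3⟩ | ⟨-, h3⟩
          · exact Or.inr (Or.inl ⟨conn_refl _ _ _, h1⟩)
          · exact Or.inl (conn_trans (conn_symm h2) h3)
          · exact Or.inl h3
        · rcases ih with h1 | ⟨-, h3⟩ | ⟨h2, h3⟩
          · exact Or.inr (Or.inr ⟨conn_refl _ _ _, h1⟩)
          · exact Or.inl h3
          · exact Or.inl (conn_trans (conn_symm h2) h3)
      · have hxz : Conn ends (Function.update ω e false) x z :=
          conn_of_openAdj ⟨e', by rw [Function.update_of_ne hee]; exact he', hends'⟩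
        rcases ih with h1 | ⟨h2, h3⟩ | ⟨h2, h3⟩
        · exact Or.inl (conn_trans hxz h1)
        · exact Or.inr (Or.inl ⟨conn_trans hxz h2, h3⟩)
        · exact Or.inr (Or.inr ⟨conn_trans hxz h2, h3⟩)
  · rintro (h1 | ⟨h2, h3⟩ | ⟨h2, h3⟩)
    · exact conn_mono hle h1
    · exact conn_trans (conn_mono hle h2) (conn_trans hea (conn_mono hle h3))
    · exact conn_trans (conn_mono hle h2) (conn_trans (conn_symm hea) (conn_mono hle h3))

end OneEdge

section Res

variable {E : Type*} [DecidableEq E]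

/-- The restriction of a configuration to the edges of `S`. -/
def res (S : Finset E) (ω : Config E) : Config {e' // e' ∈ S} := fun e' => ω e'

omit [DecidableEq E] in
/-- The restriction, pointwise. -/
@[simp] lemma res_apply (S : Finset E) (ω : Config E) (e' : {e' // e' ∈ S}) : res S ω e' = ω e' := rfl

/-- `res ∘ ext = id`. -/
lemma res_ext (S : Finset E) (ω' : Config {e' // e' ∈ S}) : res S (ext S ω') = ω' := by
  funext e'
  rw [res_apply, ext_apply_coe]

/-- A configuration closed off `S` is the extension of its restriction. -/
lemma ext_res (S : Finset E) {ω : Config E} (h : ∀ e', e' ∉ S → ω e' = false) : ext S (res S ω) = ω := by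
  funext e'
  by_cases he : e' ∈ S
  · rw [ext_apply_of_mem S _ he, res_apply]
  · rw [ext_apply_of_not_mem S _ he, h e' he]

/-- Pinning an edge off `S` does not change the restriction. -/
lemma res_update_of_not_mem (S : Finset E) (ω : Config E) {e : E} (he : e ∉ S) (b : Bool) :
    res S (Function.update ω e b) = res S ω := by
  funext e'
  have : (e' : E) ≠ e := fun h => he (h ▸ e'.2)
  simp [res, Function.update_of_ne this]

omit [DecidableEq E] in
/-- An event read through `res S` is free of every edge off `S`. -/
lemma free_of_res (S : Finset E) {e : E} (he : e ∉ S) (C : Set (Config {e' // e' ∈ S})) :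
    PendantRoot.Free e {ω | res S ω ∈ C} := by
  intro ω ω' h
  have : res S ω = res S ω' := by
    funext e'
    have hne : (e' : E) ≠ e := fun h' => he (h' ▸ e'.2)
    exact h e' hne
  simp [this]

end Res

section Block

variable {V : Type*} {E : Type*} [Fintype E] [DecidableEq E] [DecidableEq V]

variable (ends : E → Sym2 V) (e : E) {a₁ a₃ v : V}

/-- The edges other than `e`. -/
abbrev others (e : E) : Finset E := Finset.univ.erase e

omit [DecidableEq V] in
/-- `e` is not among the other edges. -/
lemma e_not_mem_others : e ∉ others e := Finset.notMem_erase e _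

omit [DecidableEq V] in
/-- Every edge other than `e` is among the other edges. -/
lemma mem_others_of_ne {e' : E} (h : e' ≠ e) : e' ∈ others e := Finset.mem_erase.2 ⟨h, Finset.mem_univ _⟩

omit [DecidableEq V] in
/-- With `e` closed, connections are those of the graph without `e`. -/
lemma conn_iff_closed {ω : Config E} (hω : ω e = false) (x y : V) :
    Conn ends ω x y ↔ Conn (restrictEnds (others e) ends) (res (others e) ω) x y := by
  have h : ∀ e', e' ∉ others e → ω e' = false := by
    intro e' he'
    have : e' = e := by
      by_contra hne
      exact he' (mem_others_of_ne e hne)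
    rw [this, hω]
  conv_lhs => rw [← ext_res (others e) h]
  exact conn_ext_iff _ ends _ x y

omit [DecidableEq V] in
/-- With `e` open, connections not through `a₃`'s side are those of the graph without `e`. -/
lemma conn_iff_open (he : ends e = s(a₃, a₁)) {ω : Config E} (hω : ω e = true) (x y : V) :
    Conn ends ω x y ↔ Conn (restrictEnds (others e) ends) (res (others e) ω) x y ∨
      (Conn (restrictEnds (others e) ends) (res (others e) ω) x a₃ ∧
        Conn (restrictEnds (others e) ends) (res (others e) ω) a₁ y) ∨
      (Conn (restrictEnds (others e) ends) (res (others e) ω) x a₁ ∧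
        Conn (restrictEnds (others e) ends) (res (others e) ω) a₃ y) := by
  rw [conn_iff_of_open_edge he hω]
  have h0 : Function.update ω e false e = false := by simp
  have hres : res (others e) (Function.update ω e false) = res (others e) ω :=
    res_update_of_not_mem _ ω (e_not_mem_others e) false
  simp only [conn_iff_closed ends e h0, hres]

variable {side : {e' // e' ∈ others e} → Bool} {L : Set V} {Rt : Set V}

omit [DecidableEq V] in
/-- **Right connections with `e` open**: on the cut-vertex graph without `e`, with `a₃ ↮ v`, a connection
between right vertices does not use `e`. -/
theorem conn_right_iff_open (h : CutVertex (restrictEnds (others e) ends) side L v Rt)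
    (he : ends e = s(a₃, a₁)) (h3 : a₃ ∈ L) {ω : Config E} (hω : ω e = true)
    (hno : ¬ Conn (restrictEnds (others e) ends) (res (others e) ω) a₃ v) {x y : V}
    (hx : x ∈ Rt ∨ x = v) (hy : y ∈ Rt ∨ y = v) :
    Conn ends ω x y ↔ Conn (restrictEnds (others e) ends) (res (others e) ω) x y := by
  rw [conn_iff_open ends e he hω]
  constructor
  · rintro (h1 | ⟨h2, -⟩ | ⟨-, h3'⟩)
    · exact h1
    · exact absurd ((conn_cross_iff h (Or.inl h3) hx _).1 (conn_symm h2)).1 hno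
    · exact absurd ((conn_cross_iff h (Or.inl h3) hy _).1 h3').1 hno
  · exact Or.inl

omit [DecidableEq V] in
/-- **`Q` with `e` open**: `a₁ ↮ v` in the full graph iff `a₁ ↮ v` and `a₃ ↮ v` without `e`. -/
theorem Q_iff_open (he : ends e = s(a₃, a₁)) {ω : Config E} (hω : ω e = true) :
    ω ∈ avoidAll ends v {a₁} ↔
      ¬ Conn (restrictEnds (others e) ends) (res (others e) ω) a₁ v ∧
        ¬ Conn (restrictEnds (others e) ends) (res (others e) ω) a₃ v := by
  simp only [avoidAll, Set.mem_setOf_eq, Finset.mem_singleton, forall_eq]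
  rw [conn_iff_open ends e he hω]
  constructor
  · intro hc
    refine ⟨fun h' => hc (Or.inl (conn_symm h')), fun h' => ?_⟩
    exact hc (Or.inr (Or.inl ⟨conn_symm h', conn_refl _ _ _⟩))
  · rintro ⟨hc1, hc3⟩ (h' | ⟨h', -⟩ | ⟨h', h''⟩)
    · exact hc1 (conn_symm h')
    · exact hc3 (conn_symm h')
    · exact hc1 (conn_symm h')

end Block

end Block

end Mix

end Summit.Ventures.PercRepro2
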